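import Summits.FinalStateConjecture.FinalStateConjecture.Theses.PhotonSphereChannels
import Literature.Geometry.Lorentzian.SpacetimeLocalConvergence
import Literature.Geometry.Lorentzian.RedShiftedHorizon
import Literature.Geometry.Lorentzian.Stationary
import Literature.Geometry.Lorentzian.QuasiFinalStateDecomposition
import Literature.Geometry.Lorentzian.LeviCivitaProofs
import HarnessLib.Audit

/-!
# Line `tame-hull-exact-rigidity-only` — skeleton for crux
`PhotonSphereChannels.ChannelsResolveTameDevelopments` (stmt-FinalStateConjecture-10046)

Crux-plan (planner) for idea card `Ideas/tame-hull-exact-rigidity-only.md` (ideator 3, round 1;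
triage r1-1/2/3: pass). Line card: `Lines/tame-hull-exact-rigidity-only.md`.
LEAD'S COPY (prover-line-stmt-FinalStateConjecture-10046-0, picked 2026-08-16T01:21Z): composition
now applies the registered stubs directly (`ChannelsResolveTameDevelopments_of`, stubs in its cone);
logic lemma kept as `channelsResolveTameDevelopments_of_stubs`.

## What the crux is, and what this line proves

The crux is literally `K1 → Φ` (`Disproof.lean`: `channelsResolve_iff`), with
`K1 = UniformPhotonSphereChannels` refuted on paper and numerics (item 10045; `Disproof.lean` §2,
F3 = `Negative.rw_channelEnergy_le` landed) — so its only provable content is the consequent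
`Φ = TameResolution` ("every MGHD of admissible data with complete `𝓘⁺`, (i) no extremal remnant,
(ii) `(r₀, Λ)`-tame outer region, settles: an honest exhaustive `FinalStateDecomposition` with
`O = exteriorOf`"), and `Φ` implies the crux (`Disproof.of_tameResolution`). This line proves `Φ`
OUTRIGHT and discharges the crux by discarding `K1` (`ChannelsResolveTameDevelopments_of`, last
step `fun _hK1 ↦ …`). No channel inequality of any kind is used: the refuting packets of K1 make a
coercivity constant vanish, and this line has no coercivity constant (card §Dead lines).

## The line (card `tame-hull-exact-rigidity-only`)

Trade every quantitative late-time statement for its `ε = 0` version on an ETERNAL object — a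
HULL ELEMENT: a pointed `C²_loc` (Cheeger–Gromov) limit of the tame outer region along
future-escaping base points — and recover the `ε/δ` statements by compactness and contradiction:

* **A** `stub_tameHullCompactness` — (ii) ⇒ hull elements exist and are eternal tame vacuum ENDS
  (posited interface `EndDatum.IsTameEnd`: far chart on the full cylinder, adapted clock,
  clock-adapted centred tame balls on the d.o.c.).
* **B** `stub_hullIsDoublySilent` — complete `𝓘⁺` + Bondi mass loss + area law (+ Barbalat) ⇒
  every hull element is doubly silent, with the zeroth-law dichotomy red-shifted/cold.
* **Q** `stub_curvatureQuantum` — Kerr d.o.c. inside a `Λ`-tame end has `M ≥ m₀(Λ)`.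
* **C** `stub_eternalDoublySilentRigidity` — THE TRANSFER `C⁺`: doubly silent + red-shifted
  eternal tame end ⇒ sub-extremal Kerr d.o.c. or Minkowski. HARDEST.
* **D** `stub_coldSilentHullIsExtremal` — cold case ⇒ extremal Kerr d.o.c. (X1 gap, named).
* **E1** `stub_quasiSettlingOfRigidHull` — rigid hull + quantum + (i) ⇒ `ε`-quasi settling ∀ ε.
* **E2** `stub_captureOfQuasiSettling` — `ε`-quasi settling ∀ ε ⇒ honest settling (capture).

`ChannelsResolveTameDevelopments_of : A → B → Q → C → D → E1 → E2 → ChannelsResolveTameDevelopments`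
is proved below without `sorry` (pure logic: E2 ∘ E1 ∘ ⟨A, B ▸ (C | D), Q⟩); its hypotheses are the
name-keyed aliases `Registered.stub_X` of the statement defs `X` (skeleton audit: admissible BY
NAME), and each registered `theorem stub_X : <same text> := by sorry` carries the text of `X`
verbatim.

## Local vocabulary (abbreviations of sub-formulas of the crux + ONE posited interface)

`NoExtremalRemnant` / `outerRegion` / `TameOuter` are VERBATIM the hypothesis (i), the `let outer`
and the hypothesis (ii) of the route decl (so that `DevHyp` is definitionally the crux's
hypothesis block; the conclusion of Φ is written out verbatim in E2); `IsFutureEscaping`,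
`EndDatum` (+ `IsTameEnd`, `IsNonRadiating`, `IsSilentHorizon`, `IsRedShifted`, `IsColdHorizon`,
`doc`, `horizon`), `IsHullElement`, `IsKerrDoc`, `IsMinkowski` are the posited interface of the line,
each over existing Literature declarations (`Spacetime.SubconvergesLocallyTo`,
`LorentzianMetric.HasSurfaceGravityGe`, `Spacetime.docOfEnd/futureEventHorizonOfEnd`,
`Spacetime.deviation(Extend)`, `IsLateChart`, `supCkENorm`, `QuasiFinalStateDecomposition`,
`Kerr.region/exterior/background`, …). The far-chart clauses copy the shape of the typed items
`FarZoneEternalPapapetrou` / `EternalStationaryExteriorIsKerr` of route EternalPapapetrou.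

## Disproof used

`Disproof.lean` (cdisprove v3) has no `_false_without_` theorem; it establishes that the crux is
`K1 → Φ` with `K1` false (`of_not_uniform`, `channelsResolve_of_F12`; landed
`Theorems/ChannelsResolveTameDevelopments/Negative/*`). This skeleton honours it by targeting `Φ`
(its conclusion verbatim, under `DevHyp`) and never using `K1`; no stub is an instance of a landed Negative lemma
(those concern the 1+1 Regge–Wheeler equation only).
-/

noncomputable section

-- the operator-norm instance on `E4 →L[ℝ] E4 →L[ℝ] ℝ` needs one more level of pending
-- instance problems than the default (as in `BoundedGeometry.lean`)
set_option maxSynthPendingDepth 3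
set_option linter.dupNamespace false

open Set Filter Function TopologicalSpace Manifold Bundle
open scoped Topology Manifold ContDiff ENNReal NNReal

namespace Summit.FinalStateConjecture.FinalStateConjecture.Cruxes.ChannelsResolveTameDevelopments.TameHullExactRigidityOnly

open Literature.Geometry.Lorentzian
open Summit.FinalStateConjecture.FinalStateConjecture.Theses.PhotonSphereChannels
  (ChannelsResolveTameDevelopments UniformPhotonSphereChannels)

/-! ### §0 The crux, cut into named pieces (verbatim sub-formulas of the route decl) -/

section Development

variable {X : Type} [TopologicalSpace X] [ChartedSpace E3 X] [IsManifold (𝓡 3) ∞ X]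
  [T2Space X] [SecondCountableTopology X] [ConnectedSpace X] {D : InitialDataSet (𝓡 3) X}

/-- Hypothesis (i) of Φ, verbatim: NO EXTREMAL REMNANT — no late-time chart from a boosted extremal
Kerr exterior along which the `C²` deviation tends to `0` on every near-zone slab. [folklore] -/
def NoExtremalRemnant (𝒟 : VacuumCauchyDevelopment D) : Prop :=
  ∀ (Λ : lorentzGroup) (c : E4) (M a : ℝ), Kerr.IsExtremal M a →
    ¬ ∃ (τ₀ : ℝ) (Ψ : (boostedKerrBackground Λ c M a).domain → 𝒟.carrier),
      𝒟.toSpacetime.IsLateChart (boostedKerrBackground Λ c M a) Set.univ τ₀ Ψ ∧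
        ∀ R : ℝ, Tendsto (fun τ => 𝒟.toSpacetime.truncDeviationCk
          (boostedKerrBackground Λ c M a) Ψ 2 R τ) atTop (𝓝 0)

/-- The OUTER REGION of Φ, verbatim the `let outer` of the route decl:
`J⁺(ι X) ∩ ⋃ I⁻(future branch of a future-complete normalised null ray from ι X)`. [folklore] -/
def outerRegion (𝒟 : VacuumCauchyDevelopment D) [𝒟.metric.HasLeviCivita] : Set 𝒟.carrier :=
  𝒟.metric.causalFuture 𝒟.timeOrientation (Set.range 𝒟.embed) ∩
    {q | ∃ (p : X) (γ : ℝ → 𝒟.carrier) (dom : Set ℝ),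
      𝒟.metric.IsNormalisedNullRayFrom 𝒟.timeOrientation 𝒟.embed 𝒟.normal p γ dom ∧
        ¬ BddAbove dom ∧
          q ∈ 𝒟.metric.chronologicalPast 𝒟.timeOrientation (γ '' (dom ∩ Set.Ici 0))}

/-- Hypothesis (ii) of Φ, verbatim: the outer region is `(r₀, Λ)`-TAME — every point is the centre
of a smooth open-embedded coordinate ball of radius `r₀` with `sup_{C³} ‖Ψ^*g − η‖ ≤ Λ` and
`sup_{C⁰} ‖Ψ^*g − η‖ ≤ 1/2`. [cite: Anderson2004, Def. 1.1 and §5] -/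
def TameOuter (𝒟 : VacuumCauchyDevelopment D) : Prop :=
  ∀ [𝒟.metric.HasLeviCivita], ∃ r₀ : ℝ, 0 < r₀ ∧ ∃ Λ : ℝ≥0, ∀ q ∈ outerRegion 𝒟,
    let U : Opens E4 := ⟨Metric.ball (0 : E4) r₀, Metric.isOpen_ball⟩
    ∃ Ψ : U → 𝒟.carrier, 𝒟.toSpacetime.IsLateChart (Minkowski.backgroundOn U) Set.univ (-r₀) Ψ ∧
      (∃ x : U, (x : E4) = 0 ∧ Ψ x = q) ∧
      supCkENorm (U : Set E4) 3 (𝒟.toSpacetime.deviationExtend (Minkowski.backgroundOn U) Ψ) ≤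
          (Λ : ℝ≥0∞) ∧
        supCkENorm (U : Set E4) 0 (𝒟.toSpacetime.deviationExtend (Minkowski.backgroundOn U) Ψ) ≤
          1 / 2

/-- The standing hypotheses of Φ on ONE development (each stub's docstring says which it uses):
MGHD, complete `𝓘⁺`, (i), (ii). [folklore] -/
structure DevHyp (𝒟 : VacuumCauchyDevelopment D) : Prop where
  /-- `𝒟` is a maximal globally hyperbolic vacuum development. -/
  maximal : 𝒟.IsMaximal
  /-- Complete future null infinity (Christodoulou, sojourn form). -/
  scri : Summit.FinalStateConjecture.HasCompleteNullInfinity 𝒟.toCauchyDevelopment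
  /-- (i) no extremal remnant. -/
  noRemnant : NoExtremalRemnant 𝒟
  /-- (ii) tame outer region. -/
  tame : TameOuter 𝒟

/-- A sequence of outer points is FUTURE-ESCAPING if it eventually leaves the causal past of every
compact set (the base points of hull elements). [folklore] -/
def IsFutureEscaping (𝒟 : VacuumCauchyDevelopment D) [𝒟.metric.HasLeviCivita]
    (q : ℕ → 𝒟.carrier) : Prop :=
  (∀ n, q n ∈ outerRegion 𝒟) ∧
    ∀ K : Set 𝒟.carrier, IsCompact K →
      ∀ᶠ n in atTop, q n ∉ 𝒟.metric.causalPast 𝒟.timeOrientation K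

end Development

/-! ### §1 The posited interface: eternal tame ends, silence, red-shift / cold, Kerr d.o.c. -/

/-- The Schwarzschild far background on the full cylinder `ℝ × {r > R}` (ingoing Kerr–Schild form
`g_{M,0}`, time `x⁰`, radius `r`) — the `B` of route EternalPapapetrou's far-chart items. [folklore] -/
def farBackground (M R : ℝ) : ModelBackground :=
  ⟨Kerr.region 0 R, Kerr.bilin M 0, fun x ↦ x 0, Kerr.radius 0⟩

/-- **End datum** of a spacetime `𝓢` (posited data of a hull element): a reference mass `M` and
inner radius `R` of the far cylinder, a bound `C`, an ETERNAL FAR CHART `far : {r > R} → 𝓢` defined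
for all `x⁰ ∈ ℝ`, and a CLOCK `clock : 𝓢 → ℝ` (the temporal function of sub-bet α). Constraints
live in `IsTameEnd`. [folklore] -/
structure EndDatum (𝓢 : Spacetime.{0} 4) where
  /-- Reference (Schwarzschild) mass of the far background. -/
  M : ℝ
  /-- Inner radius of the far cylinder. -/
  R : ℝ
  /-- The `r`-weighted `C³` bound of the far deviation. -/
  C : ℝ
  /-- The eternal far chart on `Kerr.region 0 R = ℝ × {r > max R 0}`. -/
  far : Kerr.region (0 : ℝ) R → 𝓢.carrier
  /-- The clock (temporal function), equal to `x⁰` on the far chart. -/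
  clock : 𝓢.carrier → ℝ

namespace EndDatum

variable {𝓢 : Spacetime.{0} 4}

/-- The far background of the datum. [folklore] -/
def B (E : EndDatum 𝓢) : ModelBackground := farBackground E.M E.R

/-- The far deviation `h = far^* g − g_{M,0}`, extended by zero off the cylinder. [folklore] -/
def h (E : EndDatum 𝓢) : E4 → E4 →L[ℝ] E4 →L[ℝ] ℝ := 𝓢.deviationExtend E.B E.far

/-- `∂₀ h`, the chart-time derivative of the far deviation (the order-`1/r` radiation field lives
in `r · ∂₀ h`). [folklore] -/
def hdot (E : EndDatum 𝓢) : E4 → E4 →L[ℝ] E4 →L[ℝ] ℝ := fun y ↦ fderiv ℝ E.h y (E4.basisVector 0)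

/-- The domain of outer communications of the end, `I⁺(far) ∩ I⁻(far)`. [cite: Wald1984, §12.1] -/
def doc (E : EndDatum 𝓢) : Set 𝓢.carrier := 𝓢.docOfEnd (Set.range E.far)

/-- The future event horizon of the end, `∂I⁻(far) ∩ I⁺(far)` (possibly empty). [cite: Wald1984, §12.1] -/
def horizon (E : EndDatum 𝓢) : Set 𝓢.carrier := 𝓢.futureEventHorizonOfEnd (Set.range E.far)

/-- **Eternal `(Λ, r₀)`-tame end** (posited interface; A constructs instances, C/D/Q consume them).
Clauses: `0 < r₀`; `0 ≤ M`, `max (2M) 0 < R`; VACUUM; the far chart is an injective `C^∞` local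
diffeomorphism of the whole cylinder with `‖D^m h‖ · r ≤ C` for `m ≤ 3` (uniform in `x⁰ ∈ ℝ`:
eternal, asymptotically flat, no derivative gain) whose `∂₀` is future-directed; the clock is
smooth and equals `x⁰` on the far chart; and every point of the domain of outer communications is
the CENTRE of a CLOCK-ADAPTED tame ball: a late chart of `Metric.ball 0 r₀` (Minkowski background)
with `C³`-deviation `≤ Λ`, `C⁰`-deviation `≤ 1/2`, future-directed `∂₀`, and `clock ∘ Ψ = x⁰ +
clock q` (the clock is the coordinate time of the ball — this ties every later use of the clock,
in particular surface gravity, to the tame frames; cf. RedShiftedHorizon.lean, module docstring,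
and TRIAGE r1-1 (b)). The centred balls force `𝓢` to contain a uniform collar of its d.o.c.
(across the horizon) and forbid artificial truncations. [cite: Anderson2004, Def. 1.1 and Thm 5.1] -/
structure IsTameEnd (E : EndDatum 𝓢) (Λ : ℝ≥0) (r₀ : ℝ) : Prop where
  /-- The ball radius is positive. -/
  r₀_pos : 0 < r₀
  /-- The reference mass is nonnegative. -/
  mass_nonneg : 0 ≤ E.M
  /-- The far cylinder lies outside `r = 2M`. -/
  lt_R : max (2 * E.M) 0 < E.R
  /-- Vacuum: `Ric(g) = 0`. -/
  vacuum : ∀ [𝓢.metric.HasLeviCivita], 𝓢.metric.toPseudoRiemannianMetric.IsRicciFlat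
  /-- The far chart is a `C^∞` local diffeomorphism of the cylinder … -/
  far_isLocalDiffeomorph : IsLocalDiffeomorph 𝓘(ℝ, E4) (𝓡 4) ∞ E.far
  /-- … and injective. -/
  far_injective : Function.Injective E.far
  /-- `‖D^m h‖ · r ≤ C` on the whole cylinder for `m ≤ 3`. -/
  far_bound : ∀ m ≤ 3, ∀ x : Kerr.region (0 : ℝ) E.R,
    ‖iteratedFDeriv ℝ m E.h x.1‖ * Kerr.radius 0 x.1 ≤ E.C
  /-- The far chart's `∂₀` points to the future. -/
  far_future : ∀ x : Kerr.region (0 : ℝ) E.R,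
    𝓢.timeOrientation.IsFutureDirected (mfderiv 𝓘(ℝ, E4) (𝓡 4) E.far x (E4.basisVector 0))
  /-- The clock is smooth … -/
  clock_smooth : ContMDiff (𝓡 4) 𝓘(ℝ, ℝ) ∞ E.clock
  /-- … and equals `x⁰` on the far chart. -/
  clock_far : ∀ x : Kerr.region (0 : ℝ) E.R, E.clock (E.far x) = x.1 0
  /-- Clock-adapted centred tame balls at every point of the d.o.c. -/
  tame : ∀ q ∈ E.doc,
    let U : Opens E4 := ⟨Metric.ball (0 : E4) r₀, Metric.isOpen_ball⟩
    ∃ Ψ : U → 𝓢.carrier, 𝓢.IsLateChart (Minkowski.backgroundOn U) Set.univ (-r₀) Ψ ∧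
      (∃ x : U, (x : E4) = 0 ∧ Ψ x = q) ∧
      supCkENorm (U : Set E4) 3 (𝓢.deviationExtend (Minkowski.backgroundOn U) Ψ) ≤ (Λ : ℝ≥0∞) ∧
      supCkENorm (U : Set E4) 0 (𝓢.deviationExtend (Minkowski.backgroundOn U) Ψ) ≤ 1 / 2 ∧
      (∀ x : U, 𝓢.timeOrientation.IsFutureDirected
        (mfderiv 𝓘(ℝ, E4) (𝓡 4) Ψ x (E4.basisVector 0))) ∧
      ∀ x : U, E.clock (Ψ x) = (x : E4) 0 + E.clock q

/-- **Two-sided non-radiating at order `1/r`** (silence at `𝓘⁺` AND `𝓘⁻`, chart form, as in route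
EternalPapapetrou's `FarZoneEternalPapapetrou`): `r · ‖D^m ∂₀ h‖ → 0` as `r → ∞`, uniformly in
`x⁰ ∈ ℝ`, for `m ≤ 2` — no news out, none in, for all times. [cite: AlexakisSchlue2018, Thm. 1.1] -/
def IsNonRadiating (E : EndDatum 𝓢) : Prop :=
  ∀ m ≤ 2, ∀ δ > (0 : ℝ), ∃ R' : ℝ, ∀ x : Kerr.region (0 : ℝ) E.R,
    R' < Kerr.radius 0 x.1 → ‖iteratedFDeriv ℝ m E.hdot x.1‖ * Kerr.radius 0 x.1 ≤ δ

/-- **Silent horizon**: the event horizon of the end carries a future null generator field `L`,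
`C^∞` near the horizon, normalised by the clock (`d clock (L) = 1`), tangent (the horizon is forward
invariant under the flow of `L`, as in `HasSurfaceGravityGe`), along which the horizon is
NON-EXPANDING AND SHEAR-FREE: `g(∇_v L, w) = 0` for all `v, w ⊥ L` (null second fundamental form
`χ_L = 0`; by Raychaudhuri in vacuum, `θ ≡ 0` alone forces this). Vacuous for an empty horizon. [cite: Wald1984, §12.5] -/
def IsSilentHorizon (E : EndDatum 𝓢) : Prop :=
  ∀ [𝓢.metric.HasLeviCivita], ∃ L : Π x : 𝓢.carrier, TangentSpace (𝓡 4) x,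
    (∃ 𝒩 : Set 𝓢.carrier, IsOpen 𝒩 ∧ E.horizon ⊆ 𝒩 ∧
      ContMDiffOn (𝓡 4) (𝓡 4).tangent ∞
        (fun x : 𝓢.carrier ↦ (TotalSpace.mk' E4 x (L x) : TangentBundle (𝓡 4) 𝓢.carrier)) 𝒩) ∧
    (∀ p ∈ E.horizon, 𝓢.metric.IsNull (L p) ∧ 𝓢.timeOrientation.IsFutureDirected (L p) ∧
      mvfderiv (𝓡 4) E.clock p (L p) = 1 ∧
      ∀ v w : TangentSpace (𝓡 4) p, 𝓢.metric.val p (L p) v = 0 → 𝓢.metric.val p (L p) w = 0 →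
        𝓢.metric.val p (𝓢.metric.leviCivita L p v) w = 0) ∧
    ∀ (γ : ℝ → 𝓢.carrier) (a b : ℝ), a ≤ b → IsMIntegralCurveOn γ L (Icc a b) →
      γ a ∈ E.horizon → γ b ∈ E.horizon

/-- **Uniformly red-shifted horizon** with respect to the datum's clock: surface gravity `≥ κ₀` on
the whole (eternal) horizon (`LorentzianMetric.HasSurfaceGravityGe`, Dafermos–Rodnianski Thm 7.1
hypothesis). Meaningful because the clock is tied to the tame frames (`IsTameEnd.tame`). [cite: DafermosRodnianski2008, §7.1 Thm. 7.1] -/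
def IsRedShifted (E : EndDatum 𝓢) (κ₀ : ℝ) : Prop :=
  ∀ [𝓢.metric.HasLeviCivita],
    𝓢.metric.HasSurfaceGravityGe 𝓢.timeOrientation E.horizon E.clock κ₀

/-- **Cold horizon** (clock-invariant form of `κ = 0`): the horizon is NONEMPTY and carries an
AFFINELY parametrised future null generator field (`∇_L L = 0`) whose clock rate `d clock (L)` is
bounded above and below by positive constants along the whole horizon (affine parameter and adapted
clock comparable — impossible on a non-degenerate horizon, where the affine parameter is exponential
in the clock). [cite: DafermosRodnianski2008, §3.3.2 Prop. 3.3.1] -/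
def IsColdHorizon (E : EndDatum 𝓢) : Prop :=
  E.horizon.Nonempty ∧ ∀ [𝓢.metric.HasLeviCivita],
    ∃ (L : Π x : 𝓢.carrier, TangentSpace (𝓡 4) x) (c : ℝ), 0 < c ∧
      (∃ 𝒩 : Set 𝓢.carrier, IsOpen 𝒩 ∧ E.horizon ⊆ 𝒩 ∧
      ContMDiffOn (𝓡 4) (𝓡 4).tangent ∞
        (fun x : 𝓢.carrier ↦ (TotalSpace.mk' E4 x (L x) : TangentBundle (𝓡 4) 𝓢.carrier)) 𝒩) ∧
      (∀ p ∈ E.horizon, 𝓢.metric.IsNull (L p) ∧ 𝓢.timeOrientation.IsFutureDirected (L p) ∧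
        𝓢.metric.leviCivita L p (L p) = 0 ∧
        c⁻¹ ≤ mvfderiv (𝓡 4) E.clock p (L p) ∧ mvfderiv (𝓡 4) E.clock p (L p) ≤ c) ∧
      ∀ (γ : ℝ → 𝓢.carrier) (a b : ℝ), a ≤ b → IsMIntegralCurveOn γ L (Icc a b) →
        γ a ∈ E.horizon → γ b ∈ E.horizon

end EndDatum

/-- **The region `O ⊆ 𝓢` is a Kerr exterior `(M, a)`**: an injective smooth map of
`Kerr.exterior M a = {r > r₊}` (ingoing Kerr–Schild chart) onto `O` pulling `g` back EXACTLY to the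
Kerr–Schild form, `Ψ^* g − g_{M,a} = 0` (`Spacetime.deviation` for `Kerr.background M a`),
time-oriented (`Ψ_* ∂_{t*}` future-directed where `r > 2M`, i.e. outside the ergoregion): the
black-hole, not the white-hole, exterior. [cite: DafermosLuk2017, Conjecture 1] -/
def IsKerrDoc (𝓢 : Spacetime.{0} 4) (O : Set 𝓢.carrier) (M a : ℝ) : Prop :=
  ∃ Ψ : Kerr.exterior M a → 𝓢.carrier, Function.Injective Ψ ∧ ContMDiff 𝓘(ℝ, E4) (𝓡 4) ∞ Ψ ∧
    Set.range Ψ = O ∧ (∀ x, 𝓢.deviation (Kerr.background M a) Ψ x = 0) ∧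
      ∀ x : Kerr.exterior M a, 2 * M < Kerr.radius a x.1 →
        𝓢.timeOrientation.IsFutureDirected (mfderiv 𝓘(ℝ, E4) (𝓡 4) Ψ x (E4.basisVector 0))

/-- **`𝓢` is Minkowski space**: a smooth bijection `E4 → 𝓢` pulling `g` back exactly to `η`
(`Spacetime.minkowskiDeviation Ψ = 0`), time-oriented. [cite: ChristodoulouKlainerman1993, Thm. 1.0.2] -/
def IsMinkowski (𝓢 : Spacetime.{0} 4) : Prop :=
  ∃ Ψ : E4 → 𝓢.carrier, Function.Bijective Ψ ∧ ContMDiff 𝓘(ℝ, E4) (𝓡 4) ∞ Ψ ∧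
    (∀ x, 𝓢.minkowskiDeviation Ψ x = 0) ∧
      ∀ x, 𝓢.timeOrientation.IsFutureDirected (mfderiv 𝓘(ℝ, E4) (𝓡 4) Ψ x (E4.basisVector 0))

section Hull

variable {X : Type} [TopologicalSpace X] [ChartedSpace E3 X] [IsManifold (𝓡 3) ∞ X]
  [T2Space X] [SecondCountableTopology X] [ConnectedSpace X] {D : InitialDataSet (𝓡 3) X}

/-- **Hull element** of the development `𝒟` in the tameness class `(Λ, r₀)`: a future-escaping
sequence of OUTER points `q`, a `(Λ, r₀)`-tame end `(𝓢, E)` and a base point `p` such that the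
pointed spacetimes `(𝒟, qₙ)` subconverge locally in `C²` (Cheeger–Gromov;
`Spacetime.SubconvergesLocallyTo`, no covering clause — the centred balls of `IsTameEnd` pin what
the limit must contain) to `(𝓢, p)`. The HULL is the class of all hull elements. [cite: Anderson2004, Def. 1.1] -/
def IsHullElement (𝒟 : VacuumCauchyDevelopment D) [𝒟.metric.HasLeviCivita] (Λ : ℝ≥0) (r₀ : ℝ)
    (q : ℕ → 𝒟.carrier) (𝓢 : Spacetime.{0} 4) (E : EndDatum 𝓢) (p : 𝓢.carrier) : Prop :=
  IsFutureEscaping 𝒟 q ∧ E.IsTameEnd Λ r₀ ∧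
    Spacetime.SubconvergesLocallyTo (fun _ ↦ 𝒟.toSpacetime) q 𝓢 p 2

end Hull

/-! ### §2 Stub statements (named `def … : Prop`) and the registered stubs `stub_*` (same text) -/
/-- **Stub A — tame hull compactness (card lever (a), first half; sub-bets α, γ named).**
For an MGHD of admissible data with complete `𝓘⁺`, no extremal remnant and `(r₀, Λ)`-tame outer
region, there are UNIFORM constants `(Λ', r₀')` such that every future-escaping sequence of
outer points `qₙ` (leaving `J⁻(K)` for every compact `K`) admits a HULL ELEMENT: a pointed
`C²_loc` (Cheeger–Gromov, `Spacetime.SubconvergesLocallyTo`) subsequential limit `(𝓢, p)` of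
`(𝒟, qₙ)` which is an eternal `(Λ', r₀')`-TAME END (`EndDatum.IsTameEnd`: Ricci-flat, an eternal
rest-frame far chart on the full cylinder `ℝ × {r > R}` with `r`-weighted `C³` bounds, a smooth
temporal clock `t` equal to `x⁰` at infinity, and CLOCK-ADAPTED centred tame balls at every point
of its domain of outer communications). Content (Anderson 2004, Thm 5.1 shape; Petersen Ch. 10):
(α) FRAME DRIFT — (ii) gives incoherent unit charts; the temporal function must be CONSTRUCTED
(from the Bondi rest frame of the total Bondi–Sachs momentum inward) so that the translates have
equi-bounded lapse/shift; (γ) REGULARITY — `Spacetime` carries a `C^∞` metric while (ii) is `C³`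
(Arzelà–Ascoli gives `C^{2,α}` limits only): either the crux owner restates (ii) as `C^k`-tame for
all `k` (triage global note; costs `closes` nothing) or this stub proves late-time higher
regularity (no late high-frequency cascade); (w) WEIGHTED FAR FIELD — uniform-in-time `r`-weighted
asymptotic flatness of the intermediate/far zone around each hole (the limit far chart inherits
`‖D^m h‖·r ≤ C` via `FarChartsConverge.norm_iteratedFDeriv_mul_le`), Klainerman–Nicolò exterior +
tameness + Bondi mass bounds. Size: L–XL. [cite: Anderson2004, Thm 5.1] [cite: arXiv:2508.15441, Thm 1.1] -/
def TameHullCompactness : Prop :=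
    ∀ (X : Type) [TopologicalSpace X] [ChartedSpace E3 X] [IsManifold (𝓡 3) ∞ X] [T2Space X]
      [SecondCountableTopology X] [ConnectedSpace X], ∀ D ∈ admissibleVacuumData X,
      ∀ (𝒟 : VacuumCauchyDevelopment D) [𝒟.metric.HasLeviCivita], DevHyp 𝒟 →
        ∃ (Λ' : ℝ≥0) (r₀' : ℝ), 0 < r₀' ∧ ∀ q : ℕ → 𝒟.carrier, IsFutureEscaping 𝒟 q →
          ∃ (𝓢 : Spacetime.{0} 4) (E : EndDatum 𝓢) (p : 𝓢.carrier), IsHullElement 𝒟 Λ' r₀' q 𝓢 E p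

/-- Registered stub `stub_tameHullCompactness` (statement = `TameHullCompactness`, verbatim). [folklore] -/
theorem stub_tameHullCompactness :
    ∀ (X : Type) [TopologicalSpace X] [ChartedSpace E3 X] [IsManifold (𝓡 3) ∞ X] [T2Space X]
      [SecondCountableTopology X] [ConnectedSpace X], ∀ D ∈ admissibleVacuumData X,
      ∀ (𝒟 : VacuumCauchyDevelopment D) [𝒟.metric.HasLeviCivita], DevHyp 𝒟 →
        ∃ (Λ' : ℝ≥0) (r₀' : ℝ), 0 < r₀' ∧ ∀ q : ℕ → 𝒟.carrier, IsFutureEscaping 𝒟 q →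
          ∃ (𝓢 : Spacetime.{0} 4) (E : EndDatum 𝓢) (p : 𝓢.carrier), IsHullElement 𝒟 Λ' r₀' q 𝓢 E p := by
  sorry

/-- **Stub B — the two monotone budgets make every hull element doubly silent (card lever (b);
sub-bets β, news-foliation named; uses complete `𝓘⁺`).** Every hull element `(𝓢, E, p)` of a
development as in Φ can be RE-GAUGED (new far chart in Bondi/no-incoming-radiation gauge, new
adapted clock; same domain of outer communications) to an eternal tame end which is
(1) TWO-SIDED NON-RADIATING at order `1/r` (`IsNonRadiating`: `r·‖D^m ∂₀h‖ → 0` uniformly on the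
whole cylinder — future side: Bondi mass loss `newsFlux ≤ 32π E_ADM` (`IsNewsCanonical`) upgraded
from `tendsto_newsFlux_Ici` to POINTWISE silence by Barbalat once the limit's news power is
uniformly continuous (first lemma `QuietScriFromBudget`, SketchIdeator3.lean, provable now); past
side: admissible data radiate no incoming news at late advanced time (Fatou); needs the
news-canonical foliation of a complete-`𝓘⁺` tame development — Christodoulou–Klainerman Ch. 17 /
Klainerman–Nicolò exterior), (2) HORIZON-SILENT (`IsSilentHorizon`: the limit event horizon is a
non-expanding shear-free null hypersurface with clock-normalised complete generators — area theorem
Chruściel–Delay–Galloway–Howard + the horizon AREA BOUND β (`sup_v Area < ∞`, Penrose-type, open in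
general; tree: hypothesis structure `PenroseHorizonAreaBound`) + Barbalat + Raychaudhuri; horizon
lineage of limits), and (3) satisfies the ZEROTH-LAW DICHOTOMY for its clock: uniformly red-shifted
(`κ ≥ κ₀ > 0`, `HasSurfaceGravityGe`) or COLD (affine generators tick at clock rate bounded above and
below) — the stub, not logic, chooses the good clock (isolated-horizon zeroth law,
Ashtekar–Beetle–Lewandowski). Size: L–XL. [cite: ChruscielEtAl2001, Thm 1.1]
[cite: ChristodoulouKlainerman1993, Ch. 17] -/
def HullIsDoublySilent : Prop :=
    ∀ (X : Type) [TopologicalSpace X] [ChartedSpace E3 X] [IsManifold (𝓡 3) ∞ X] [T2Space X]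
      [SecondCountableTopology X] [ConnectedSpace X], ∀ D ∈ admissibleVacuumData X,
      ∀ (𝒟 : VacuumCauchyDevelopment D) [𝒟.metric.HasLeviCivita], DevHyp 𝒟 →
        ∀ (Λ : ℝ≥0) (r₀ : ℝ) (q : ℕ → 𝒟.carrier) (𝓢 : Spacetime.{0} 4) (E : EndDatum 𝓢)
          (p : 𝓢.carrier), IsHullElement 𝒟 Λ r₀ q 𝓢 E p →
          ∃ (E' : EndDatum 𝓢) (Λ' : ℝ≥0) (r₀' : ℝ), E'.IsTameEnd Λ' r₀' ∧ E'.doc = E.doc ∧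
            E'.IsNonRadiating ∧ E'.IsSilentHorizon ∧
            ((∃ κ₀ : ℝ, 0 < κ₀ ∧ E'.IsRedShifted κ₀) ∨ E'.IsColdHorizon)

/-- Registered stub `stub_hullIsDoublySilent` (statement = `HullIsDoublySilent`, verbatim). [folklore] -/
theorem stub_hullIsDoublySilent :
    ∀ (X : Type) [TopologicalSpace X] [ChartedSpace E3 X] [IsManifold (𝓡 3) ∞ X] [T2Space X]
      [SecondCountableTopology X] [ConnectedSpace X], ∀ D ∈ admissibleVacuumData X,
      ∀ (𝒟 : VacuumCauchyDevelopment D) [𝒟.metric.HasLeviCivita], DevHyp 𝒟 →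
        ∀ (Λ : ℝ≥0) (r₀ : ℝ) (q : ℕ → 𝒟.carrier) (𝓢 : Spacetime.{0} 4) (E : EndDatum 𝓢)
          (p : 𝓢.carrier), IsHullElement 𝒟 Λ r₀ q 𝓢 E p →
          ∃ (E' : EndDatum 𝓢) (Λ' : ℝ≥0) (r₀' : ℝ), E'.IsTameEnd Λ' r₀' ∧ E'.doc = E.doc ∧
            E'.IsNonRadiating ∧ E'.IsSilentHorizon ∧
            ((∃ κ₀ : ℝ, 0 < κ₀ ∧ E'.IsRedShifted κ₀) ∨ E'.IsColdHorizon) := by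
  sorry

/-- **Stub Q — the curvature quantum (card lever (c), DKM's `E ≥ E(W)` with the hole as soliton).**
There is `m₀ = m₀(Λ) > 0` such that whenever the domain of outer communications of a
`(Λ, r₀)`-tame end is (isometric to) a Kerr exterior `{r > r₊}` with `0 < M`, `|a| ≤ M`, then
`M ≥ m₀`: every point of the d.o.c. is the centre of a tame ball with `‖D^m(Ψ^*g − η)‖ ≤ Λ`,
`m ≤ 3`, and `‖Ψ^*g − η‖ ≤ 1/2`, hence the Kretschmann scalar is `≤ c(Λ + Λ²)²` at every d.o.c.
point, while on the Kerr exterior `sup K ≥ K(r ↓ r₊, θ = π/2) = 48M²/r₊⁶ ≥ 3/(4M⁴)`. Consumed by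
E1 (`N ≤ E_ADM/m₀`, finitely many excursions). Size: M on paper, L in Lean (Kretschmann of
`Kerr.bilin`). [cite: arXiv07060622, (35)] [cite: Anderson2004, (5.3)] -/
def CurvatureQuantum : Prop :=
    ∀ (Λ : ℝ≥0) (r₀ : ℝ), 0 < r₀ → ∃ m₀ : ℝ, 0 < m₀ ∧
      ∀ (𝓢 : Spacetime.{0} 4) (E : EndDatum 𝓢), E.IsTameEnd Λ r₀ →
        ∀ M a : ℝ, 0 < M → |a| ≤ M → IsKerrDoc 𝓢 E.doc M a → m₀ ≤ M

/-- Registered stub `stub_curvatureQuantum` (statement = `CurvatureQuantum`, verbatim). [folklore] -/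
theorem stub_curvatureQuantum :
    ∀ (Λ : ℝ≥0) (r₀ : ℝ), 0 < r₀ → ∃ m₀ : ℝ, 0 < m₀ ∧
      ∀ (𝓢 : Spacetime.{0} 4) (E : EndDatum 𝓢), E.IsTameEnd Λ r₀ →
        ∀ M a : ℝ, 0 < M → |a| ≤ M → IsKerrDoc 𝓢 E.doc M a → m₀ ≤ M := by
  sorry

/-- **Stub C — `C⁺ = EternalDoublySilentRigidity`, the Transfer of the card (HARDEST; open).**
An eternal tame vacuum end (`IsTameEnd`) which is two-sided non-radiating at order `1/r`
(`IsNonRadiating`), whose event horizon is non-expanding and shear-free (`IsSilentHorizon`) and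
UNIFORMLY RED-SHIFTED with respect to its adapted clock (`IsRedShifted κ₀`, `κ₀ > 0`: the κ-floor X1
of the triage, consumed HERE and tied to the tame charts through the clock-adapted balls of
`IsTameEnd` — an untied clock would be a free reparametrisation, RedShiftedHorizon.lean) has domain
of outer communications isometric to a SUB-EXTREMAL Kerr exterior (`0 < M`, `|a| < M`, one
component), or the whole spacetime is Minkowski. Why easier than Φ: ONE object, ALL fluxes exactly
zero, complete and bounded in BOTH time directions, hypotheses invariant under `t ↦ −t`; no rate,
no modulation, no smallness: unique continuation from infinity (Alexakis–Schlue–Shao; two-sided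
eternity replaces periodicity, arXiv:1504.04592 p. 8) gives the stationary far zone (= route
EternalPapapetrou's typed crux `FarZoneEternalPapapetrou`, stmt-10034, same far-chart clauses),
the red-shifted silent horizon gives the Hawking collar (secular `e^{−kκv}` modes die under
two-sided boundedness; AIK bifurcate rigidity arXiv:0902.1173 / Petersen–Rácz arXiv:1903.09135),
and the remaining gap is Ionescu–Klainerman's extension across the photon region (barrier
`KillingExtensionObstruction`, caveat (g)) — refutable by ONE explicit spacetime (card: C-metric,
NUT, Tomimatsu–Sato, Majumdar–Papapetrou, IK local hair all fail a hypothesis). Size: XL / open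
problem. [cite: AlexakisIonescuKlainerman2009, Thm 1.1] [cite: arXiv:1504.04592, Thm 1.3]
[cite: IonescuKlainerman2012, Thm 1.1] [cite: ChruscielCostaHeusler2012, §3] -/
def EternalDoublySilentRigidity : Prop :=
    ∀ (𝓢 : Spacetime.{0} 4) (E : EndDatum 𝓢) (Λ : ℝ≥0) (r₀ : ℝ), E.IsTameEnd Λ r₀ →
      E.IsNonRadiating → E.IsSilentHorizon → (∃ κ₀ : ℝ, 0 < κ₀ ∧ E.IsRedShifted κ₀) →
        (∃ M a : ℝ, 0 < M ∧ |a| < M ∧ IsKerrDoc 𝓢 E.doc M a) ∨ IsMinkowski 𝓢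

/-- Registered stub `stub_eternalDoublySilentRigidity` (statement = `EternalDoublySilentRigidity`, verbatim). [folklore] -/
theorem stub_eternalDoublySilentRigidity :
    ∀ (𝓢 : Spacetime.{0} 4) (E : EndDatum 𝓢) (Λ : ℝ≥0) (r₀ : ℝ), E.IsTameEnd Λ r₀ →
      E.IsNonRadiating → E.IsSilentHorizon → (∃ κ₀ : ℝ, 0 < κ₀ ∧ E.IsRedShifted κ₀) →
        (∃ M a : ℝ, 0 < M ∧ |a| < M ∧ IsKerrDoc 𝓢 E.doc M a) ∨ IsMinkowski 𝓢 := by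
  sorry

/-- **Stub D — the cold case (the X1 gap of the triage, named as a statement).** An eternal tame
vacuum end which is two-sided non-radiating, horizon-silent and COLD (`IsColdHorizon`: nonempty
event horizon whose AFFINE generators tick at clock rate bounded above and below — the degenerate
`κ = 0` case in clock-invariant form; a non-degenerate horizon is never cold because its affine
parameter is exponential in any adapted clock) has domain of outer communications isometric to an
EXTREMAL Kerr exterior (`|a| = M > 0`). First step in print: intrinsic rigidity of extremal
horizons (Dunajski–Lucietti arXiv:2306.17512: a vacuum extremal horizon with compact sections is an
extremal Kerr horizon); the exterior continuation is the degenerate no-hair problem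
(Chruściel–Nguyen, Amsel–Horowitz–Marolf–Roberts under axisymmetry) — open. Planner-facing remedy
(triage r1-1/2/3): restate hypothesis (i) of the crux as `HasEventuallyRedShiftedHorizon` w.r.t.
the tame clock; then B's dichotomy has no cold branch and this stub drops out. E1 kills the
extremal hull elements this stub produces with (i). Size: XL / open problem.
[cite: arXiv:2306.17512, Thm 1.1] [cite: ChruscielCostaHeusler2012, §3.5] -/
def ColdSilentHullIsExtremal : Prop :=
    ∀ (𝓢 : Spacetime.{0} 4) (E : EndDatum 𝓢) (Λ : ℝ≥0) (r₀ : ℝ), E.IsTameEnd Λ r₀ →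
      E.IsNonRadiating → E.IsSilentHorizon → E.IsColdHorizon →
        ∃ M a : ℝ, Kerr.IsExtremal M a ∧ IsKerrDoc 𝓢 E.doc M a

/-- Registered stub `stub_coldSilentHullIsExtremal` (statement = `ColdSilentHullIsExtremal`, verbatim). [folklore] -/
theorem stub_coldSilentHullIsExtremal :
    ∀ (𝓢 : Spacetime.{0} 4) (E : EndDatum 𝓢) (Λ : ℝ≥0) (r₀ : ℝ), E.IsTameEnd Λ r₀ →
      E.IsNonRadiating → E.IsSilentHorizon → E.IsColdHorizon →
        ∃ M a : ℝ, Kerr.IsExtremal M a ∧ IsKerrDoc 𝓢 E.doc M a := by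
  sorry

/-- **Stub E1 — compactness-by-contradiction: a rigid hull forces `ε`-quasi settling for every
`ε` (card lever (a) second half + (c); uses hypothesis (i)).** If hull elements exist for every
future-escaping outer sequence, every hull element's d.o.c. is a Kerr exterior (`|a| ≤ M`) or the
element is Minkowski, and Kerr hull masses are `≥ m₀ > 0`, then there are a sub-extremality
margin `δ > 0`, a mass floor and a bound `N₀` on the number of holes such that FOR EVERY `ε > 0`
the self-determined exterior carries an `ε`-quasi `2`-decomposition with exhaustive charts
(`QuasiFinalStateDecomposition` — orbital form of the conclusion of Φ; the `∃ δ m₀ N₀ …` block below, shared verbatim with E2's hypothesis) whose reference holes obey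
`m₀ ≤ Mᵢ`, `|aᵢ| ≤ (1 − δ) Mᵢ`, `N ≤ N₀`. Proof shape: negate, pick bad late points, extract hull
elements (A), read off exact Kerr/flat geometry (C/D), contradiction — exactness replaces every
coercive inequality (no channels, no Łojasiewicz); the quantum gives `N₀ ≤ E_ADM/m₀` and finitely
many `ε`-excursions (DKM energy quantisation); (i) plus monotonicity of horizon areas and Bondi
mass excludes extremal parameters in the closed hull, whence `δ`; horizon-normalised hole charts
and causal bookkeeping give `O = exteriorOf` and the covering clause. Hidden inputs to name in the
proof: closedness of the hull, per-hole charge identification (no energy parked at intermediate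
scales — shared with A(w)), mass census `Σ Mᵢ ≤ E_ADM`. Size: L–XL.
[cite: doi:10.4310/cjm.2013.v1.n1.a3, Thm 1] [cite: arXiv:1601.01871, §3] -/
def QuasiSettlingOfRigidHull : Prop :=
    ∀ (X : Type) [TopologicalSpace X] [ChartedSpace E3 X] [IsManifold (𝓡 3) ∞ X] [T2Space X]
      [SecondCountableTopology X] [ConnectedSpace X], ∀ D ∈ admissibleVacuumData X,
      ∀ (𝒟 : VacuumCauchyDevelopment D) [𝒟.metric.HasLeviCivita], DevHyp 𝒟 →
        (∃ (Λ : ℝ≥0) (r₀ : ℝ), 0 < r₀ ∧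
          (∀ q : ℕ → 𝒟.carrier, IsFutureEscaping 𝒟 q →
            ∃ (𝓢 : Spacetime.{0} 4) (E : EndDatum 𝓢) (p : 𝓢.carrier), IsHullElement 𝒟 Λ r₀ q 𝓢 E p) ∧
          (∀ (q : ℕ → 𝒟.carrier) (𝓢 : Spacetime.{0} 4) (E : EndDatum 𝓢) (p : 𝓢.carrier),
            IsHullElement 𝒟 Λ r₀ q 𝓢 E p →
              (∃ M a : ℝ, 0 < M ∧ |a| ≤ M ∧ IsKerrDoc 𝓢 E.doc M a) ∨ IsMinkowski 𝓢) ∧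
          (∃ m₀ : ℝ, 0 < m₀ ∧
            ∀ (q : ℕ → 𝒟.carrier) (𝓢 : Spacetime.{0} 4) (E : EndDatum 𝓢) (p : 𝓢.carrier),
              IsHullElement 𝒟 Λ r₀ q 𝓢 E p →
                ∀ M a : ℝ, 0 < M → |a| ≤ M → IsKerrDoc 𝓢 E.doc M a → m₀ ≤ M)) →
        (∃ (δ m₀ : ℝ) (N₀ : ℕ), 0 < δ ∧ 0 < m₀ ∧ ∀ ε : ℝ, 0 < ε →
          ∃ (O : Set 𝒟.carrier)
            (d : QuasiFinalStateDecomposition 𝒟.toSpacetime O 2 (ENNReal.ofReal ε)),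
            d.HasExhaustiveCharts ∧
              O = Summit.FinalStateConjecture.exteriorOf 𝒟.toCauchyDevelopment d.charted ∧
                d.N ≤ N₀ ∧ ∀ i, m₀ ≤ d.mass i ∧ |d.spin i| ≤ (1 - δ) * d.mass i)

/-- Registered stub `stub_quasiSettlingOfRigidHull` (statement = `QuasiSettlingOfRigidHull`, verbatim). [folklore] -/
theorem stub_quasiSettlingOfRigidHull :
    ∀ (X : Type) [TopologicalSpace X] [ChartedSpace E3 X] [IsManifold (𝓡 3) ∞ X] [T2Space X]
      [SecondCountableTopology X] [ConnectedSpace X], ∀ D ∈ admissibleVacuumData X,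
      ∀ (𝒟 : VacuumCauchyDevelopment D) [𝒟.metric.HasLeviCivita], DevHyp 𝒟 →
        (∃ (Λ : ℝ≥0) (r₀ : ℝ), 0 < r₀ ∧
          (∀ q : ℕ → 𝒟.carrier, IsFutureEscaping 𝒟 q →
            ∃ (𝓢 : Spacetime.{0} 4) (E : EndDatum 𝓢) (p : 𝓢.carrier), IsHullElement 𝒟 Λ r₀ q 𝓢 E p) ∧
          (∀ (q : ℕ → 𝒟.carrier) (𝓢 : Spacetime.{0} 4) (E : EndDatum 𝓢) (p : 𝓢.carrier),
            IsHullElement 𝒟 Λ r₀ q 𝓢 E p →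
              (∃ M a : ℝ, 0 < M ∧ |a| ≤ M ∧ IsKerrDoc 𝓢 E.doc M a) ∨ IsMinkowski 𝓢) ∧
          (∃ m₀ : ℝ, 0 < m₀ ∧
            ∀ (q : ℕ → 𝒟.carrier) (𝓢 : Spacetime.{0} 4) (E : EndDatum 𝓢) (p : 𝓢.carrier),
              IsHullElement 𝒟 Λ r₀ q 𝓢 E p →
                ∀ M a : ℝ, 0 < M → |a| ≤ M → IsKerrDoc 𝓢 E.doc M a → m₀ ≤ M)) →
        (∃ (δ m₀ : ℝ) (N₀ : ℕ), 0 < δ ∧ 0 < m₀ ∧ ∀ ε : ℝ, 0 < ε →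
          ∃ (O : Set 𝒟.carrier)
            (d : QuasiFinalStateDecomposition 𝒟.toSpacetime O 2 (ENNReal.ofReal ε)),
            d.HasExhaustiveCharts ∧
              O = Summit.FinalStateConjecture.exteriorOf 𝒟.toCauchyDevelopment d.charted ∧
                d.N ≤ N₀ ∧ ∀ i, m₀ ≤ d.mass i ∧ |d.spin i| ≤ (1 - δ) * d.mass i) := by
  sorry

/-- **Stub E2 — capture (card lever (d): asymptotic stability of sub-extremal multi-Kerr is
literature-plus-handoff).** For an MGHD as in Φ, `ε`-quasi settling for EVERY `ε > 0` with
uniform margins (`N ≤ N₀`, `m₀ ≤ Mᵢ`, `|aᵢ| ≤ (1 − δ)Mᵢ`; E1's conclusion verbatim) upgrades to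
the conclusion of Φ verbatim — an honest exhaustive `FinalStateDecomposition` with `O = exteriorOf` (orbital ⇒ asymptotic stability; named
as the open upgrade in `QuasiFinalStateDecomposition.lean`'s docstring). Inputs: Kerr stability
(`klainerman_szeftel_kerr_stability_small_a`, GKS arXiv:2205.14808, for `|a| ≪ M`; Hintz for the
full range `|a| < M` — preprint, honest-conditional: barrier `SlowlyRotatingKerrFrontier`),
superposition at large separation for `N ≥ 2`, and the WEIGHTED FAR-FIELD HANDOFF: stability
theorems want `r`-weighted smallness on a slice reaching `𝓘⁺` (DHRT characteristic data,
arXiv:2104.08222 §1, or hyperboloidal), not the unweighted `C²` slab closeness of a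
quasi-decomposition, whose AF slabs still carry `E_ADM − M_f` at `i⁰`; bridge on late outgoing
cones modulo a BMS supertranslation (`σ_∞ = ð²f` is gauge), using Bondi mass `→ M_f` and the
`r^p`-perturbative far zone. `ε` is chosen below the stability threshold `ε_*(δ, m₀, N₀)`.
Size: XL (literature-conditional). [cite: KlainermanSzeftel2023, Thm 1.1]
[cite: GiorgiKlainermanSzeftel2022, Thm 1] [cite: arXiv:2104.08222, §1] [cite: arXiv:1306.5364, Thm 1] -/
def CaptureOfQuasiSettling : Prop :=
    ∀ (X : Type) [TopologicalSpace X] [ChartedSpace E3 X] [IsManifold (𝓡 3) ∞ X] [T2Space X]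
      [SecondCountableTopology X] [ConnectedSpace X], ∀ D ∈ admissibleVacuumData X,
      ∀ (𝒟 : VacuumCauchyDevelopment D) [𝒟.metric.HasLeviCivita], DevHyp 𝒟 →
        (∃ (δ m₀ : ℝ) (N₀ : ℕ), 0 < δ ∧ 0 < m₀ ∧ ∀ ε : ℝ, 0 < ε →
          ∃ (O : Set 𝒟.carrier)
            (d : QuasiFinalStateDecomposition 𝒟.toSpacetime O 2 (ENNReal.ofReal ε)),
            d.HasExhaustiveCharts ∧
              O = Summit.FinalStateConjecture.exteriorOf 𝒟.toCauchyDevelopment d.charted ∧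
                d.N ≤ N₀ ∧ ∀ i, m₀ ≤ d.mass i ∧ |d.spin i| ≤ (1 - δ) * d.mass i) →
        ∃ (O : Set 𝒟.carrier) (d : FinalStateDecomposition 𝒟.toSpacetime O 2),
          O = Summit.FinalStateConjecture.exteriorOf 𝒟.toCauchyDevelopment d.charted ∧
            Summit.FinalStateConjecture.HasExhaustiveCharts d

/-- Registered stub `stub_captureOfQuasiSettling` (statement = `CaptureOfQuasiSettling`, verbatim). [folklore] -/
theorem stub_captureOfQuasiSettling :
    ∀ (X : Type) [TopologicalSpace X] [ChartedSpace E3 X] [IsManifold (𝓡 3) ∞ X] [T2Space X]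
      [SecondCountableTopology X] [ConnectedSpace X], ∀ D ∈ admissibleVacuumData X,
      ∀ (𝒟 : VacuumCauchyDevelopment D) [𝒟.metric.HasLeviCivita], DevHyp 𝒟 →
        (∃ (δ m₀ : ℝ) (N₀ : ℕ), 0 < δ ∧ 0 < m₀ ∧ ∀ ε : ℝ, 0 < ε →
          ∃ (O : Set 𝒟.carrier)
            (d : QuasiFinalStateDecomposition 𝒟.toSpacetime O 2 (ENNReal.ofReal ε)),
            d.HasExhaustiveCharts ∧
              O = Summit.FinalStateConjecture.exteriorOf 𝒟.toCauchyDevelopment d.charted ∧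
                d.N ≤ N₀ ∧ ∀ i, m₀ ≤ d.mass i ∧ |d.spin i| ≤ (1 - δ) * d.mass i) →
        ∃ (O : Set 𝒟.carrier) (d : FinalStateDecomposition 𝒟.toSpacetime O 2),
          O = Summit.FinalStateConjecture.exteriorOf 𝒟.toCauchyDevelopment d.charted ∧
            Summit.FinalStateConjecture.HasExhaustiveCharts d := by
  sorry


/-! ### §3 Name-keyed aliases of the registered stubs

`Registered.stub_X : Prop` is the statement `X` of the registered stub `stub_X` under the stub's own
short name, so that the native skeleton audit (`#h21_check_skeleton`: the hypotheses of the composing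
theorem are admissible iff they are registered obligations / declared stubs BY NAME) reads the
hypotheses of `ChannelsResolveTameDevelopments_of` as the seven registered stubs (convention of
`Cruxes/NecksCertify/Lines/bargmann-small-late-exterior.lean`; the `stub` audit attribute itself is
gate-reserved and may not be written in a crux workfile). -/
namespace Registered

/-- Statement of `stub_tameHullCompactness` (= `TameHullCompactness`). [folklore] -/
abbrev stub_tameHullCompactness : Prop := TameHullCompactness
/-- Statement of `stub_hullIsDoublySilent` (= `HullIsDoublySilent`). [folklore] -/
abbrev stub_hullIsDoublySilent : Prop := HullIsDoublySilent
/-- Statement of `stub_curvatureQuantum` (= `CurvatureQuantum`). [folklore] -/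
abbrev stub_curvatureQuantum : Prop := CurvatureQuantum
/-- Statement of `stub_eternalDoublySilentRigidity` (= `EternalDoublySilentRigidity`). [folklore] -/
abbrev stub_eternalDoublySilentRigidity : Prop := EternalDoublySilentRigidity
/-- Statement of `stub_coldSilentHullIsExtremal` (= `ColdSilentHullIsExtremal`). [folklore] -/
abbrev stub_coldSilentHullIsExtremal : Prop := ColdSilentHullIsExtremal
/-- Statement of `stub_quasiSettlingOfRigidHull` (= `QuasiSettlingOfRigidHull`). [folklore] -/
abbrev stub_quasiSettlingOfRigidHull : Prop := QuasiSettlingOfRigidHull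
/-- Statement of `stub_captureOfQuasiSettling` (= `CaptureOfQuasiSettling`). [folklore] -/
abbrev stub_captureOfQuasiSettling : Prop := CaptureOfQuasiSettling

end Registered

/-- Consistency check: the registered (sorried) stubs prove their name-keyed statements, i.e. the
texts of `stub_X`, `X` and `Registered.stub_X` agree. -/
example : Registered.stub_tameHullCompactness ∧ Registered.stub_hullIsDoublySilent ∧
    Registered.stub_curvatureQuantum ∧ Registered.stub_eternalDoublySilentRigidity ∧
    Registered.stub_coldSilentHullIsExtremal ∧ Registered.stub_quasiSettlingOfRigidHull ∧
    Registered.stub_captureOfQuasiSettling :=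
  ⟨stub_tameHullCompactness, stub_hullIsDoublySilent, stub_curvatureQuantum,
    stub_eternalDoublySilentRigidity, stub_coldSilentHullIsExtremal, stub_quasiSettlingOfRigidHull,
    stub_captureOfQuasiSettling⟩

/-! ### §4 The composition (kernel-checked, no `sorry` of its own): the crux BY NAME -/


/-- **Logic of the line: the seven stub STATEMENTS imply the crux.** Pure logic: E2 after E1,
fed by A (hull elements exist, in one uniform tameness class), Q (mass gap for that class) and
B-then-(C or D) (every hull element is, after B's re-gauging and zeroth-law dichotomy, a Kerr
d.o.c. with `|a| ≤ M` or Minkowski); the antecedent `K1 = UniformPhotonSphereChannels` of the crux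
is discarded (the crux is `K1 → Φ`, `Disproof.channelsResolve_iff`; this is
`Disproof.of_tameResolution` inlined). Hypotheses (i)∧(ii) of the crux are definitionally
`NoExtremalRemnant 𝒟 ∧ TameOuter 𝒟` and its conclusion is E2's, verbatim. Sorry-free. -/
theorem channelsResolveTameDevelopments_of_stubs (hA : Registered.stub_tameHullCompactness)
    (hB : Registered.stub_hullIsDoublySilent) (hQ : Registered.stub_curvatureQuantum)
    (hC : Registered.stub_eternalDoublySilentRigidity) (hDc : Registered.stub_coldSilentHullIsExtremal)
    (hE1 : Registered.stub_quasiSettlingOfRigidHull) (hE2 : Registered.stub_captureOfQuasiSettling) :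
    ChannelsResolveTameDevelopments := by
  intro _hK1 X _ _ _ _ _ _ D hD 𝒟 hmax hscri hhyp
  haveI : 𝒟.metric.HasLeviCivita := 𝒟.metric.toPseudoRiemannianMetric.hasLeviCivita
  have hdev : DevHyp 𝒟 := ⟨hmax, hscri, hhyp.1, hhyp.2⟩
  refine hE2 X D hD 𝒟 hdev (hE1 X D hD 𝒟 hdev ?_)
  obtain ⟨Λ, r₀, hr₀, hhull⟩ := hA X D hD 𝒟 hdev
  obtain ⟨m₀, hm₀, hgap⟩ := hQ Λ r₀ hr₀
  refine ⟨Λ, r₀, hr₀, hhull, ?_, m₀, hm₀, ?_⟩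
  · intro q 𝓢 E p hhe
    obtain ⟨E', Λ', r₀', htame, hdoc, hnr, hsil, hdich⟩ := hB X D hD 𝒟 hdev Λ r₀ q 𝓢 E p hhe
    rcases hdich with hred | hcold
    · rcases hC 𝓢 E' Λ' r₀' htame hnr hsil hred with ⟨M, a, hM, ha, hK⟩ | hMink
      · exact Or.inl ⟨M, a, hM, ha.le, hdoc ▸ hK⟩
      · exact Or.inr hMink
    · obtain ⟨M, a, hext, hK⟩ := hDc 𝓢 E' Λ' r₀' htame hnr hsil hcold
      exact Or.inl ⟨M, a, hext.2, hext.1.le, hdoc ▸ hK⟩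
  · intro q 𝓢 E p hhe M a hM ha hK
    exact hgap 𝓢 E hhe.2.1 M a hM ha hK

/-- **`ChannelsResolveTameDevelopments` from the line `tame-hull-exact-rigidity-only`** (lead's
skeleton, prover-line-stmt-FinalStateConjecture-10046-0): the composition applied to the seven
registered stubs `stub_*` — the only `sorry`s of this file sit in those stubs, and this theorem
concludes the ROUTE decl by its name. When the last stub closes this is the closing theorem. -/
theorem ChannelsResolveTameDevelopments_of :
    Summit.FinalStateConjecture.FinalStateConjecture.Theses.PhotonSphereChannels.ChannelsResolveTameDevelopments :=
  channelsResolveTameDevelopments_of_stubs stub_tameHullCompactness stub_hullIsDoublySilent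
    stub_curvatureQuantum stub_eternalDoublySilentRigidity stub_coldSilentHullIsExtremal
    stub_quasiSettlingOfRigidHull stub_captureOfQuasiSettling

end Summit.FinalStateConjecture.FinalStateConjecture.Cruxes.ChannelsResolveTameDevelopments.TameHullExactRigidityOnly

end
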